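import Summits.ResolutionOfSingularities.ResolutionOfSingularities.Theorems.HomologicalConductorNoZenoRationalAscentPuncturedRegular
import Literature.AlgebraicGeometry.Resolution.QuasiExcellentFiniteType
import Literature.AlgebraicGeometry.Resolution.FieldsJ2
import HarnessLib

/-!
# Crux `NoZenoR` (stmt-ResolutionOfSingularities-19943) — G0a «the singular sandwiched stage has a RATIONAL singularity»
# MODULO statement B) instead of Lipman (1.2): `hasRationalSingularity_tower` with `Lipman1969_1_2 ↦ Lipman1969_1_2_B`

Route `ResolutionOfSingularities/HomologicalConductor` (cell decomp-res, hand leafhand-res-homologicalconduct-12 g1).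
OURS: AI-written, weaker than expert review; nothing here is a statement of the manuscript under review (Hironaka 2017).
SUPPORT level (`--supports stmt-19943`), counted 0.  Def-free.  Named fact consumed: only the hypothesis
`(hB : Lipman1969_1_2_B)` (statement B) of Lipman's proof of (1.2), special case of Zariski's Thm (26.1)).

* `hasRationalSingularity_of_isLocalization_of_B_of_isOpen` — the ring-form drop-in of `…RationalAscentDropIn` /
  `…PuncturedRegular` with the binders the chain can supply: `T = B_𝔮` an ISOLATED SINGULARITY of dimension `2` and the
  regular locus of `Spec B` OPEN (maximality of `𝔮` is derived: `𝔮` has coheight `2 = dim Spec B`).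
* `hasRationalSingularity_tower_of_B` — **G0a mod B)**: `NoZeno.SandwichCluster.hasRationalSingularity_tower` with
  `(h12 : Lipman1969_1_2)` replaced by `(hB : Lipman1969_1_2_B)` and ONE extra binder `Algebra.EssFiniteType k ↥R` on the
  regular base of the sandwich context (then `R` is J-2 — `Resolution.isJ2Ring_of_field`, `IsJ2Ring.of_essFiniteType` — so
  the finitely generated model `B₀` has open regular locus; at the chain's instantiations `R` is a tower stage, essentially of
  finite type over `k` by `tn_tower_invariant`).
* `hasTrivialCechH1_of_isResolution_tower_of_B`, `minResolutionExists_of_B` — the two G-layer consumers re-based likewise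
  (the second still modulo `Lipman1969_4_1`).

With hand 11's `Lipman1969_1_2_B.hasTrivialCechH1_of_isResolution`, the print `Lipman1969_1_2` is thereby replaceable by
`Lipman1969_1_2_B` at BOTH of its consumed forms in the W4.4 chain (by-name registry texts unchanged).
No crux, kill test or summit statement is proved; resolution of singularities in positive characteristic is NOT proved.

## References
* J. Lipman, *Rational singularities …*, Publ. Math. IHÉS 36 (1969): Prop. (1.2), p. 199–200; statement B). [Lipman1969]
* The Stacks Project, Tag 07QU (J-2 and essentially finite type algebras). [StacksProject]
-/

-- single-problem summit: the doubled namespace component `ResolutionOfSingularities` is forced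
set_option linter.dupNamespace false

noncomputable section

namespace Summit.ResolutionOfSingularities.ResolutionOfSingularities.Theorems.NoZeno.RationalAscent

open CategoryTheory CategoryTheory.Limits AlgebraicGeometry TopologicalSpace IsLocalRing
open Literature.AlgebraicGeometry.Resolution Literature.AlgebraicGeometry.Morphisms
open Literature.RingTheory.CohomologyAnnihilator
open Summit.ResolutionOfSingularities.ResolutionOfSingularities.Theorems.SurfaceTermination.GenusDescent
open Summit.ResolutionOfSingularities.ResolutionOfSingularities.Theorems.NoZeno.SandwichCluster
open Summit.ResolutionOfSingularities.ResolutionOfSingularities.Theorems.NoZeno.Birth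

/-! ## The drop-in with binders «isolated singularity + open regular locus» -/

/-- **Lipman (1.2) 1) in ring form over a REGULAR base, MODULO B), binders «isolated singularity + open regular locus».**
`R` regular local of dimension `2`; `B ⊇ R` a finitely generated domain with a common denominator; `𝔮` a prime with
`T = B_𝔮` local of dimension `2` and an isolated singularity; the regular locus of `Spec B` open.  Then `T` has a rational
singularity.  (`𝔮` is maximal: its coheight `dim B_𝔮 = 2` is the dimension of the birational model `Spec B`.)
[cite: Lipman1969, Proposition (1.2) 1), proof p. 200 with footnote (1); statement B) (p. 200)] -/
theorem hasRationalSingularity_of_isLocalization_of_B_of_isOpen (hB : Lipman1969_1_2_B.{0}) {R B T : Type}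
    [CommRing R] [IsDomain R] [IsRegularLocalRing R] (hdimR : ringKrullDim R = 2)
    [CommRing B] [IsDomain B] [Algebra R B] [Algebra.FiniteType R B]
    (hinj : Function.Injective (algebraMap R B)) (r : R) (hr : r ≠ 0)
    (hden : ∀ b : B, ∃ n : ℕ, ∃ a : R, algebraMap R B a = algebraMap R B r ^ n * b)
    (𝔮 : Ideal B) [𝔮.IsPrime] [CommRing T] [Algebra B T] [IsLocalRing T] [IsLocalization.AtPrime T 𝔮]
    (hdimT : ringKrullDim T = 2) (hiso : IsIsolatedSingularity T)
    (hopen : IsOpen (Literature.AlgebraicGeometry.Resolution.regularLocus B)) :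
    HasRationalSingularity T := by
  classical
  haveI : IsNoetherianRing B := Algebra.FiniteType.isNoetherianRing R B
  haveI : IsDomain (CommRingCat.of B) := ‹IsDomain B›
  haveI : IsNoetherianRing (CommRingCat.of B) := ‹IsNoetherianRing B›
  haveI : IsNoetherianRing (CommRingCat.of R) := (inferInstance : IsNoetherianRing R)
  -- `𝔮` is maximal: the point `𝔮` of the birational model `Spec B` (of dimension `≤ 2`) has coheight `dim T = 2`
  haveI : 𝔮.IsMaximal := by
    let g : Spec (.of B) ⟶ Spec (.of R) := Spec.map (CommRingCat.ofHom (algebraMap R B))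
    haveI : LocallyOfFiniteType g := by
      rw [HasRingHomProperty.Spec_iff (P := @LocallyOfFiniteType)]
      exact RingHom.finiteType_algebraMap.mpr ‹Algebra.FiniteType R B›
    have hbir : IsBirational g := isBirational_specMap_of_denominator hinj r hr hden
    haveI : IsNoetherian (Spec (.of B)) := {}
    have hdimY : topologicalKrullDim (Spec (.of B)) ≤ 2 := by
      refine hbir.topologicalKrullDim_le_of_isNoetherian.trans ?_
      change topologicalKrullDim (PrimeSpectrum R) ≤ 2
      rw [PrimeSpectrum.topologicalKrullDim_eq_ringKrullDim]
      exact hdimR.le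
    let y : Spec (.of B) := ⟨𝔮, ‹𝔮.IsPrime›⟩
    letI : Algebra B ((Spec (.of B)).presheaf.stalk y) := StructureSheaf.stalkAlgebra B y
    haveI : IsLocalization.AtPrime ((Spec (.of B)).presheaf.stalk y) 𝔮 :=
      StructureSheaf.IsLocalization.to_stalk B y
    let e : (Spec (.of B)).presheaf.stalk y ≃ₐ[B] T := IsLocalization.algEquiv 𝔮.primeCompl _ _
    have hdimy : ringKrullDim ((Spec (.of B)).presheaf.stalk y) = 2 := by
      rw [ringKrullDim_eq_of_ringEquiv e.toRingEquiv]; exact hdimT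
    have hy : IsClosed ({y} : Set (Spec (.of B))) := by
      refine isClosed_singleton_of_two_le_coheight hdimY (le_of_eq ?_)
      have h2 : ((Order.coheight y : ℕ∞) : WithBot ℕ∞) = ((2 : ℕ∞) : WithBot ℕ∞) := by
        rw [← ringKrullDim_stalk_eq_coheight, hdimy]; rfl
      exact (WithBot.coe_injective h2).symm
    exact (PrimeSpectrum.isClosed_singleton_iff_isMaximal y).mp hy
  -- the singular locus is closed: `= V(I)` for its vanishing ideal
  let C : Set (PrimeSpectrum B) := (Literature.AlgebraicGeometry.Resolution.regularLocus B)ᶜ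
  have hC : IsClosed C := hopen.isClosed_compl
  let I : Ideal B := PrimeSpectrum.vanishingIdeal C
  have hCI : PrimeSpectrum.zeroLocus (I : Set B) = C :=
    (PrimeSpectrum.zeroLocus_vanishingIdeal_eq_closure C).trans hC.closure_eq
  have hI : ∀ (𝔭 : Ideal B) [𝔭.IsPrime], ¬ IsRegularLocalRing (Localization.AtPrime 𝔭) ↔ I ≤ 𝔭 := by
    intro 𝔭 _
    have h1 : (⟨𝔭, ‹𝔭.IsPrime›⟩ : PrimeSpectrum B) ∈ C ↔ ¬ IsRegularLocalRing (Localization.AtPrime 𝔭) := Iff.rfl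
    rw [← h1, ← hCI, PrimeSpectrum.mem_zeroLocus, SetLike.coe_subset_coe]
  exact hasRationalSingularity_of_isLocalization_of_B' hB hdimR hinj r hr hden 𝔮 hdimT hiso I hI

/-! ## G0a, G0b, GE of the W4.4 chain, modulo B) -/

section Tower

variable {k K : Type} [Field k] [Field K] [Algebra k K]

/-- **G0a mod B): the singular sandwiched stage has a RATIONAL singularity** — `hasRationalSingularity_tower` with
`Lipman1969_1_2 ↦ Lipman1969_1_2_B` and the extra binder `Algebra.EssFiniteType k ↥R` (making `R` J-2, so that the
finitely generated model `B₀ ⊆ T_m` has open regular locus); `T_m` is an isolated singularity by `stage_package`.  The rest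
is the original proof verbatim. [cite: Lipman1969, Proposition (1.2) 1) (p. 199)] [cite: StacksProject, Tag 07QU] -/
theorem hasRationalSingularity_tower_of_B (hB : Lipman1969_1_2_B.{0}) (O : ValuationSubring K)
    (A R : Subalgebra k K) (m₀ : ℕ) (ctx : SandwichCtx O A R m₀) [Algebra.EssFiniteType k ↥R]
    (m : ℕ) (hm : m₀ + 1 ≤ m)
    (hsing : ¬ IsRegularLocalRing ↥(tower O A m)) : HasRationalSingularity ↥(tower O A m) := by
  obtain ⟨hk, hA, hfr, hAO, -, hRreg, hRfr, -, -, hRT⟩ := id ctx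
  obtain ⟨_, _, _, _, hdimT, hiso, hdimR⟩ := stage_package O A R m₀ ctx m hm hsing
  haveI := hRreg
  haveI := hRfr
  set T : Subalgebra k K := tower O A m with hTdef
  have hRT' : R ≤ T := hRT m (by omega)
  -- `T` as an `R`-algebra, essentially of finite type
  letI : Algebra ↥R ↥T := (Subalgebra.inclusion hRT').toRingHom.toAlgebra
  haveI : IsScalarTower k ↥R ↥T := IsScalarTower.of_algebraMap_eq fun c => rfl
  haveI : Algebra.EssFiniteType k ↥T := (tn_tower_invariant O A hk hA hfr hAO m).2.2
  haveI : Algebra.EssFiniteType ↥R ↥T := Algebra.EssFiniteType.of_comp k ↥R ↥T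
  -- the finitely generated model `B₀` and the prime `𝔮 = 𝔪_T ∩ B₀`
  set B₀ : Subalgebra ↥R ↥T := Algebra.EssFiniteType.subalgebra ↥R ↥T with hB₀
  let 𝔮 : Ideal ↥B₀ := (maximalIdeal ↥T).comap (algebraMap ↥B₀ ↥T)
  haveI : 𝔮.IsPrime := Ideal.comap_isPrime _ _
  have hsub : Algebra.EssFiniteType.submonoid ↥R ↥T = 𝔮.primeCompl := by
    ext x
    simp only [Algebra.EssFiniteType.submonoid, Submonoid.mem_comap, IsUnit.mem_submonoid_iff,
      Ideal.primeCompl, 𝔮]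
    change _ ↔ algebraMap (↥B₀) (↥T) x ∉ maximalIdeal ↥T
    rw [IsLocalRing.mem_maximalIdeal, mem_nonunits_iff, not_not]
  haveI : IsLocalization.AtPrime ↥T 𝔮 := by
    rw [IsLocalization.AtPrime, ← hsub]; infer_instance
  -- injectivity of `R → B₀` and the common denominator
  have hcoe : ∀ a : ↥R, (((algebraMap ↥R ↥B₀ a : ↥B₀) : ↥T) : K) = (a : K) := fun a => rfl
  have hinj : Function.Injective (algebraMap ↥R ↥B₀) := by
    intro a b h
    have := congrArg (fun x : ↥B₀ => ((x : ↥T) : K)) h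
    simp only [hcoe] at this
    exact Subtype.ext this
  obtain ⟨r, hr0, hden⟩ := exists_denominator_adjoin R T hRT' (Algebra.EssFiniteType.finset ↥R ↥T)
  have hB' : ∀ b : ↥B₀, ∃ n : ℕ, ∃ a : ↥R,
      algebraMap ↥R ↥B₀ a = algebraMap ↥R ↥B₀ r ^ n * b := by
    intro b
    obtain ⟨n, a, h⟩ := hden b b.2
    refine ⟨n, a, Subtype.ext (Subtype.ext ?_)⟩
    rw [hcoe]
    push_cast
    rw [h]
    rfl
  -- `R` is J-2 (essentially of finite type over the field `k`), so `Reg(B₀)` is open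
  have hJ2 : IsJ2Ring ↥R := (isJ2Ring_of_field k).of_essFiniteType inferInstance
  have hopen : IsOpen (Literature.AlgebraicGeometry.Resolution.regularLocus ↥B₀) := hJ2.2 ↥B₀ inferInstance
  exact hasRationalSingularity_of_isLocalization_of_B_of_isOpen hB hdimR hinj r hr0 hB' 𝔮 (T := ↥T) hdimT hiso hopen

/-- **G0b mod B)**: every resolution of the singular late stage has `H¹(X, 𝒪_X) = 0` (`hasTrivialCechH1_of_isResolution_tower`
with `Lipman1969_1_2 ↦ Lipman1969_1_2_B`, via hand 11's `Lipman1969_1_2_B.hasTrivialCechH1_of_isResolution`).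
[cite: Lipman1969, Proposition (1.2) 2) (p. 199)] -/
theorem hasTrivialCechH1_of_isResolution_tower_of_B (hB : Lipman1969_1_2_B.{0}) (O : ValuationSubring K)
    (A R : Subalgebra k K) (m₀ : ℕ) (ctx : SandwichCtx O A R m₀) [Algebra.EssFiniteType k ↥R]
    (m : ℕ) (hm : m₀ + 1 ≤ m)
    (hsing : ¬ IsRegularLocalRing ↥(tower O A m)) {X : Scheme.{0}}
    (π : X ⟶ Spec (.of ↥(tower O A m))) (hπ : IsResolution π) : HasTrivialCechH1 π := by
  obtain ⟨_, hN, _, _, hdimT, -, -⟩ := stage_package O A R m₀ ctx m hm hsing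
  haveI := hN
  exact Lipman1969_1_2_B.hasTrivialCechH1_of_isResolution hB hdimT
    (hasRationalSingularity_tower_of_B hB O A R m₀ ctx m hm hsing) π hπ

/-- **GE mod B) (and (4.1))**: the singular late stage has a minimal resolution (`minResolutionExists_of_lipman` with
`Lipman1969_1_2 ↦ Lipman1969_1_2_B`). [cite: Lipman1969, Theorem (4.1) (p. 204)] -/
theorem minResolutionExists_of_B (hB : Lipman1969_1_2_B.{0}) (h41 : Lipman1969_4_1.{0})
    (O : ValuationSubring K) (A R : Subalgebra k K) (m₀ : ℕ) (ctx : SandwichCtx O A R m₀) [Algebra.EssFiniteType k ↥R]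
    (m : ℕ) (hm : m₀ + 1 ≤ m) (hsing : ¬ IsRegularLocalRing ↥(tower O A m)) :
    ∃ (X : AlgebraicGeometry.Scheme.{0}) (π : X ⟶ AlgebraicGeometry.Spec (CommRingCat.of ↥(tower O A m))),
      Literature.AlgebraicGeometry.Resolution.IsMinimalResolution π := by
  obtain ⟨_, _, _, _, hdimT, -, -⟩ := stage_package O A R m₀ ctx m hm hsing
  exact h41.exists_isMinimalResolution_Spec ↥(tower O A m) hdimT
    (hasRationalSingularity_tower_of_B hB O A R m₀ ctx m hm hsing)

end Tower

end Summit.ResolutionOfSingularities.ResolutionOfSingularities.Theorems.NoZeno.RationalAscent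

end
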